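import Summits.Parity.BatemanHorn.Theorems.AlmostPrimeZerosSystemLSDRealSegmentSmoothKernel
import Summits.Parity.BatemanHorn.Theorems.AlmostPrimeZerosSystemLSDRealSegmentTruncStatExpansion
import Summits.Parity.BatemanHorn.Theorems.AlmostPrimeZerosSystemLSDRealSegmentSmoothSandwich
import Summits.Parity.BatemanHorn.Theorems.AlmostPrimeZerosSystemLSDRealSegmentSmoothSupportEulerProduct
import Summits.Parity.BatemanHorn.Theorems.AlmostPrimeZerosSystemLSDRealSegmentEulerProductAsymp
import Summits.Parity.BatemanHorn.Theorems.AlmostPrimeZerosSystemLSDRealSegmentTwistedLocalProduct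
import Summits.Parity.BatemanHorn.Theorems.SelbergDelangeRigidityLSDRealSegmentTypeI
import HarnessLib

/-!
# `SystemLSDRealSegment` (stmt-Parity-11292), line `beta-thinned-root-kernel`: the `y`-tilted Kubilius model at
# height `x^θ` — the law of the TRUNCATED statistic, I: ratio form (lead c9, companion to the rough-tuple localisation)

For a Bateman–Horn system `f = (f₁,…,f_k)`, real `y ≥ 1` and a height `S`, the truncated capped statistic
`s_{f,S}(n) = Σᵢ Σ_{p<S} min(v_p(fᵢ(n)), 2)` counts only the prime factors `< S`.  Its `y`-moment is computable:

* `sum_truncStat_eq_add` — `Σ_{n≤x} y^{s_{f,S}(n)}` = (S-smooth divisor tuples of level `≤ x`) + (smooth part of the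
  kernel), via the truncated expansion `truncStat_expansion`;
* `mainTerm_tail_bounds` — `0 ≤ ∏_{p<S}E_p(y) − Σ_{m≤x, S-smooth} b(m) ≤ x^{−δ} ∏_{p<S} Σ_ν b(p^ν)(p^ν)^δ` (Rankin), with
  `E_p(y) = Σ_{ν≤2k} b(p^ν) ≥ 1` the real local factor of the crux's `λ_f`;
* `truncStat_ratio_law` — there is `C > 0` with, for every `θ ∈ (0,1]`, `ε > 0` and all large `x` (`S = ⌊x^θ⌋₊ + 1`):
  `|Σ_{n≤x} y^{s_{f,S}(n)} / ((x+1)∏_{p<S}E_p(y)) − 1| ≤ C e^{−1/θ} + ε`;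
* (file `…TruncatedLaw.lean`) `truncStat_law_normalised` — the same in the crux's normalisation, constant
  `Re λ_f(y)·e^{γk(y−1)}·θ^{k(y−1)}`.

Compare the crux: the SAME normalised sum with the full statistic `s_f` is conjectured to tend to
`λ_f(y)·D^{y−1}Γ(y)^{−k}`; unconditionally, at every fixed height `x^θ` the `y`-tilted model is the finite Euler product
of its local factors up to `O(e^{−1/θ})`, with the Mertens factor `(e^γ θ)^{k(y−1)}` in place of `D^{y−1}Γ(y)^{−k}` — the
difference is exactly the (open) law of the prime factors `> x^θ` (the rough-kernel stubs of the skeleton).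
Inputs: `smoothTypeI_sandwich`, `smoothSupport_eulerProduct`, `twistedLocalProduct_le`, `eulerProduct_primesLE_asymp`,
`smoothKernel_le` (all landed), Levin–Faĭnleĭb for `b` (`exists_eulerFactor_ofReal`).  Everything is PROVED; no definitions.
-/

open Filter Finset Polynomial
open scoped BigOperators Topology

namespace Summit.Parity.BatemanHorn.Cruxes.SystemLSDRealSegment.BetaThinnedRootKernel

open Literature.NumberTheory.Sieve

noncomputable section

/-! ### The truncated statistic at height `S`: exact decomposition and the main-term pieces -/

section Law

variable {k : ℕ} {f : Fin k → ℤ[X]}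

/-- `Σ_{n≤x} y^{s_{f,S}(n)} = (smooth level-≤x tuple sum) + (smooth part of the kernel)`. [folklore] -/
theorem sum_truncStat_eq_add (f : Fin k → ℤ[X]) (y : ℝ) (S x : ℕ) :
    ∑ n ∈ range (x + 1), y ^ (∑ i, (((f i).eval (n : ℤ)).toNat.factorization.sum
        fun p v => if p < S then min v 2 else 0)) =
      (∑ n ∈ range (x + 1), ∑ d ∈ (tuples f n).filter
          (fun d => ∏ i, d i ≤ x ∧ (∏ i, d i) ∈ Nat.smoothNumbers S), ∏ i, thinWeight y (d i)) +
      (∑ n ∈ range (x + 1), ∑ d ∈ (tuples f n).filter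
          (fun d => x < ∏ i, d i ∧ (∏ i, d i) ∈ Nat.smoothNumbers S), ∏ i, thinWeight y (d i)) := by
  rw [← Finset.sum_add_distrib]
  refine Finset.sum_congr rfl fun n _ => ?_
  rw [truncStat_expansion k f y S n]
  have h1 : (tuples f n).filter (fun d => ∏ i, d i ≤ x ∧ (∏ i, d i) ∈ Nat.smoothNumbers S) =
      ((tuples f n).filter (fun d => (∏ i, d i) ∈ Nat.smoothNumbers S)).filter (fun d => ∏ i, d i ≤ x) := by
    rw [Finset.filter_filter]
    exact Finset.filter_congr fun d _ => and_comm
  have h2 : (tuples f n).filter (fun d => x < ∏ i, d i ∧ (∏ i, d i) ∈ Nat.smoothNumbers S) =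
      ((tuples f n).filter (fun d => (∏ i, d i) ∈ Nat.smoothNumbers S)).filter (fun d => ¬ (∏ i, d i ≤ x)) := by
    rw [Finset.filter_filter]
    exact Finset.filter_congr fun d _ => by rw [not_le, and_comm]
  rw [h1, h2, Finset.sum_filter_add_sum_filter_not]

/-- The finite Euler product `E_S = ∏_{p<S} E_p(y)` is the full `b`-mass of the divisors of `∏_{p<S} p^{2k}`. [folklore] -/
theorem sum_divisors_bCoeff_eq_prod (f : Fin k → ℤ[X]) (y : ℝ) (S : ℕ) :
    ∑ m ∈ (∏ p ∈ Nat.primesBelow S, p ^ (2 * k)).divisors, bCoeff f y m =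
      ∏ p ∈ Nat.primesBelow S, ∑ ν ∈ range (2 * k + 1), bCoeff f y (p ^ ν) := by
  have h := (smoothSupport_eulerProduct k f y S).1 0
  simp only [Real.rpow_zero, mul_one] at h
  exact h

/-- **Rankin tail of the main term**: for `y ≥ 1`, `x ≥ 1`, `δ ≥ 0`,
`0 ≤ E_S − Σ_{m ≤ x, S-smooth} b(m) ≤ x^{−δ} ∏_{p<S} Σ_ν b(p^ν)(p^ν)^δ`. [folklore] -/
theorem mainTerm_tail_bounds (f : Fin k → ℤ[X]) {y : ℝ} (hy : 1 ≤ y) (S : ℕ) {x : ℕ} (hx : 1 ≤ x)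
    {δ : ℝ} (hδ : 0 ≤ δ) :
    0 ≤ (∏ p ∈ Nat.primesBelow S, ∑ ν ∈ range (2 * k + 1), bCoeff f y (p ^ ν)) -
        ∑ m ∈ (Icc 1 x).filter (· ∈ Nat.smoothNumbers S), bCoeff f y m ∧
    (∏ p ∈ Nat.primesBelow S, ∑ ν ∈ range (2 * k + 1), bCoeff f y (p ^ ν)) -
        ∑ m ∈ (Icc 1 x).filter (· ∈ Nat.smoothNumbers S), bCoeff f y m ≤
      (x : ℝ) ^ (-δ) * ∏ p ∈ Nat.primesBelow S, ∑ ν ∈ range (2 * k + 1), bCoeff f y (p ^ ν) * ((p ^ ν : ℕ) : ℝ) ^ δ := by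
  set P : ℕ := ∏ p ∈ Nat.primesBelow S, p ^ (2 * k) with hP
  have hb0 : ∀ m, 0 ≤ bCoeff f y m := fun m => bCoeff_nonneg f hy m
  rw [(smoothSupport_eulerProduct k f y S).2 x, ← sum_divisors_bCoeff_eq_prod,
    ← (smoothSupport_eulerProduct k f y S).1 δ]
  have hsplit := Finset.sum_filter_add_sum_filter_not P.divisors (fun m => m ≤ x) (fun m => bCoeff f y m)
  have htail : ∑ m ∈ P.divisors, bCoeff f y m - ∑ m ∈ P.divisors.filter (· ≤ x), bCoeff f y m =
      ∑ m ∈ P.divisors.filter (fun m => ¬ m ≤ x), bCoeff f y m := by linarith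
  rw [htail]
  refine ⟨Finset.sum_nonneg fun m _ => hb0 m, ?_⟩
  have hx0 : (0 : ℝ) < x := by exact_mod_cast hx
  rw [Finset.mul_sum]
  calc ∑ m ∈ P.divisors.filter (fun m => ¬ m ≤ x), bCoeff f y m
      ≤ ∑ m ∈ P.divisors.filter (fun m => ¬ m ≤ x), (x : ℝ) ^ (-δ) * (bCoeff f y m * (m : ℝ) ^ δ) := by
        refine Finset.sum_le_sum fun m hm => ?_
        rw [Finset.mem_filter, not_le] at hm
        have hm0 : (0 : ℝ) < m := by exact_mod_cast lt_of_le_of_lt (Nat.zero_le _) hm.2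
        have hxm : (x : ℝ) ≤ m := by exact_mod_cast hm.2.le
        -- `1 ≤ x^{-δ} m^δ`
        have h1 : 1 ≤ (x : ℝ) ^ (-δ) * (m : ℝ) ^ δ := by
          rw [Real.rpow_neg hx0.le, ← div_eq_inv_mul, le_div_iff₀ (Real.rpow_pos_of_pos hx0 _), one_mul]
          exact Real.rpow_le_rpow hx0.le hxm hδ
        calc bCoeff f y m = bCoeff f y m * 1 := (mul_one _).symm
          _ ≤ bCoeff f y m * ((x : ℝ) ^ (-δ) * (m : ℝ) ^ δ) := mul_le_mul_of_nonneg_left h1 (hb0 m)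
          _ = (x : ℝ) ^ (-δ) * (bCoeff f y m * (m : ℝ) ^ δ) := by ring
    _ ≤ ∑ m ∈ P.divisors, (x : ℝ) ^ (-δ) * (bCoeff f y m * (m : ℝ) ^ δ) :=
        Finset.sum_le_sum_of_subset_of_nonneg (Finset.filter_subset _ _) fun m _ _ =>
          mul_nonneg (Real.rpow_nonneg hx0.le _) (mul_nonneg (hb0 m) (Real.rpow_nonneg (Nat.cast_nonneg _) _))

/-- `E_S ≥ 1` for `y ≥ 1` (each `E_p(y) ≥ 1`). [folklore] -/
theorem one_le_prod_localSum (hf : IsBatemanHornSystem f) {y : ℝ} (hy : 1 ≤ y) (S : ℕ) :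
    1 ≤ ∏ p ∈ Nat.primesBelow S, ∑ ν ∈ range (2 * k + 1), bCoeff f y (p ^ ν) := by
  calc (1 : ℝ) = ∏ _p ∈ Nat.primesBelow S, (1 : ℝ) := by simp
    _ ≤ _ := Finset.prod_le_prod (fun _ _ => zero_le_one) fun p hp =>
        one_le_localSum hf hy (Nat.mem_primesBelow.1 hp).2

/-! ### The law of the truncated statistic (ratio form) -/

/-- **The `y`-tilted Kubilius model at height `x^θ` (ratio form).**  For a Bateman–Horn system `f` and real
`y ≥ 1` there is `C > 0` such that for every `θ ∈ (0, 1]`, every `ε > 0` and all large `x`,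
`|Σ_{n≤x} y^{s_{f,S}(n)} / ((x+1) ∏_{p<S} E_p(y)) − 1| ≤ C e^{−1/θ} + ε`, `S = ⌊x^θ⌋₊ + 1`
(`s_{f,S}(n) = Σᵢ Σ_{p<S} min(v_p(fᵢ(n)), 2)`, `E_p(y) = Σ_{ν≤2k} b(p^ν)`): the mean of `y^{s_{f,S}}` is the finite Euler
product of the local means, up to `O(e^{−1/θ})` (smooth Type-I sandwich at level `x`, Rankin tail of the main term,
smooth-kernel bound). [folklore] -/
theorem truncStat_ratio_law (hf : IsBatemanHornSystem f) {y : ℝ} (hy : 1 ≤ y) :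
    ∃ C : ℝ, 0 < C ∧ ∀ θ : ℝ, 0 < θ → θ ≤ 1 → ∀ ε : ℝ, 0 < ε → ∀ᶠ x : ℕ in atTop,
      |(∑ n ∈ range (x + 1), y ^ (∑ i, (((f i).eval (n : ℤ)).toNat.factorization.sum
            fun p v => if p < ⌊(x : ℝ) ^ θ⌋₊ + 1 then min v 2 else 0))) /
          (((x : ℝ) + 1) * ∏ p ∈ Nat.primesBelow (⌊(x : ℝ) ^ θ⌋₊ + 1),
            ∑ ν ∈ range (2 * k + 1), bCoeff f y (p ^ ν)) - 1| ≤ C * Real.exp (-1 / θ) + ε := by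
  set κ : ℝ := (k : ℝ) * (y - 1) with hκ
  have hκ0 : 0 ≤ κ := mul_nonneg (Nat.cast_nonneg _) (by linarith)
  have hb0 : ∀ m, 0 ≤ bCoeff f y m := fun m => bCoeff_nonneg f hy m
  obtain ⟨C₁, hC₁⟩ := smoothTypeI_sandwich k f hf y hy
  have hC₁0 : 0 ≤ C₁ := by
    have h := hC₁ 0 0
    simp only [zero_add] at h
    have h' := (abs_nonneg _).trans h
    simp at h'
    nlinarith [hb0 1]
  obtain ⟨C₂, hC₂, x₂, hK⟩ := smoothKernel_le hf hy
  obtain ⟨B, hB⟩ := twistedLocalProduct_le hf hy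
  set Λ₀ : ℝ := (eulerFactor f (y : ℂ)).re * Real.exp (Real.eulerMascheroniConstant * κ) with hΛ₀
  have hΛ₀pos : 0 < Λ₀ := mul_pos (eulerFactor_re_pos hf hy) (Real.exp_pos _)
  have hT5 := eulerProduct_primesLE_asymp k f hf y hy
  -- `E_N ≥ (Λ₀/2)(log N)^κ` for `N ≥ N₀`
  obtain ⟨N₀, hN₀⟩ := eventually_atTop.1 (hT5.eventually (Ioi_mem_nhds (half_lt_self hΛ₀pos)))
  -- the Type-I error is `o(x (log x)^κ)`
  obtain ⟨P, -, -, hG⟩ := exists_eulerFactor_ofReal hf hy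
  have hH := LSDRealSegment.ProductAnatomySubcritical.tendsto_sum_mul_div_of_tendsto (bCoeff f y) hb0 κ hG
  have h1x : Tendsto (fun x : ℕ => 1 / ((x : ℝ) * Real.log x ^ κ)) atTop (𝓝 0) := by
    refine tendsto_of_tendsto_of_tendsto_of_le_of_le' tendsto_const_nhds tendsto_one_div_atTop_nhds_zero_nat ?_ ?_
    · filter_upwards [eventually_ge_atTop 3] with x hx
      have hx3 : (3 : ℝ) ≤ x := by exact_mod_cast hx
      have hlog : 1 ≤ Real.log x := by
        rw [Real.le_log_iff_exp_le (by linarith)]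
        exact (Real.exp_one_lt_d9.le.trans (by norm_num)).trans hx3
      positivity
    · filter_upwards [eventually_ge_atTop 3] with x hx
      have hx3 : (3 : ℝ) ≤ x := by exact_mod_cast hx
      have hlog : 1 ≤ Real.log x := by
        rw [Real.le_log_iff_exp_le (by linarith)]
        exact (Real.exp_one_lt_d9.le.trans (by norm_num)).trans hx3
      have h1 : (1 : ℝ) ≤ Real.log x ^ κ := Real.one_le_rpow hlog hκ0
      have hx0 : (0 : ℝ) < x := by linarith
      rw [one_div_le_one_div (by positivity) hx0]
      nlinarith
  -- the constant
  refine ⟨Real.exp B + C₂ * (2 : ℝ) ^ (κ + 1) / Λ₀, by positivity, fun θ hθ hθ1 ε hε => ?_⟩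
  -- thresholds in `x`
  have hxθ : Tendsto (fun x : ℕ => (x : ℝ) ^ θ) atTop atTop :=
    (tendsto_rpow_atTop hθ).comp tendsto_natCast_atTop_atTop
  set η : ℝ := ε * (Λ₀ / 2) * (θ / 2) ^ κ / (C₁ + 1) with hη
  have hηpos : 0 < η := by positivity
  have hsmall : ∀ᶠ x : ℕ in atTop,
      (1 + ∑ m ∈ Icc 1 x, (m : ℝ) * bCoeff f y m) / ((x : ℝ) * Real.log x ^ κ) ≤ η := by
    have h := h1x.add hH
    rw [zero_add] at h
    filter_upwards [h.eventually (Iio_mem_nhds hηpos)] with x hx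
    rw [← add_div] at hx
    exact hx.le
  filter_upwards [eventually_ge_atTop (max x₂ 3), hxθ.eventually_ge_atTop ((max N₀ 4 : ℕ) : ℝ), hsmall]
    with x hx hxN hxs
  have hxx₂ : x₂ ≤ x := le_of_max_le_left hx
  have hx3 : (3 : ℝ) ≤ x := by exact_mod_cast le_of_max_le_right hx
  have hx0 : (0 : ℝ) < x := by linarith
  have hx1 : (1 : ℝ) ≤ x := by linarith
  have hlogx : 0 < Real.log x := Real.log_pos (by linarith)
  -- the height
  set N : ℕ := ⌊(x : ℝ) ^ θ⌋₊ with hNdef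
  set S : ℕ := N + 1 with hSdef
  have hNge : max N₀ 4 ≤ N := Nat.le_floor hxN
  have hN₀le : N₀ ≤ N := le_of_max_le_left hNge
  have hN4 : 4 ≤ N := le_of_max_le_right hNge
  have hN4r : (4 : ℝ) ≤ N := by exact_mod_cast hN4
  have hN0 : (0 : ℝ) < N := by linarith
  have hS2 : 2 ≤ S := by omega
  have hxθpos : 0 < (x : ℝ) ^ θ := by positivity
  have hNle : (N : ℝ) ≤ (x : ℝ) ^ θ := Nat.floor_le hxθpos.le
  have hNgt : (x : ℝ) ^ θ < N + 1 := Nat.lt_floor_add_one _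
  have hxθ4 : (4 : ℝ) ≤ (x : ℝ) ^ θ := hN4r.trans hNle
  have hθlogx : Real.log ((x : ℝ) ^ θ) = θ * Real.log x := Real.log_rpow hx0 θ
  have hlogN : 0 < Real.log N := Real.log_pos (by linarith)
  have hSr : (S : ℝ) = N + 1 := by rw [hSdef]; push_cast; ring
  have hS0 : (0 : ℝ) < S := by rw [hSr]; linarith
  have hlogS : 0 < Real.log S := Real.log_pos (by rw [hSr]; linarith)
  -- `log S ≤ 2 log N`, `log S ≤ 2 θ log x`, `(θ/2) log x ≤ log N`
  have hlogS_le : Real.log S ≤ 2 * Real.log N := by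
    rw [hSr, show (2 : ℝ) * Real.log N = Real.log ((N : ℝ) ^ 2) by rw [Real.log_pow]; ring]
    exact Real.log_le_log (by linarith) (by nlinarith [hN4r])
  have hlogS_le' : Real.log S ≤ 2 * (θ * Real.log x) := by
    have h2 : Real.log 2 ≤ θ * Real.log x := by
      rw [← hθlogx]; exact Real.log_le_log (by norm_num) (by linarith)
    calc Real.log S ≤ Real.log (2 * (x : ℝ) ^ θ) := Real.log_le_log hS0 (by rw [hSr]; linarith)
      _ = Real.log 2 + θ * Real.log x := by rw [Real.log_mul (by norm_num) hxθpos.ne', hθlogx]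
      _ ≤ 2 * (θ * Real.log x) := by linarith
  have hlogN_ge : θ / 2 * Real.log x ≤ Real.log N := by
    -- `N ≥ x^θ/2 ≥ x^{θ/2}` as `x^{θ/2} ≥ 2`
    have hhalf : (x : ℝ) ^ (θ / 2) * (x : ℝ) ^ (θ / 2) = (x : ℝ) ^ θ := by
      rw [← Real.rpow_add hx0]; ring_nf
    have h2 : (2 : ℝ) ≤ (x : ℝ) ^ (θ / 2) := by
      by_contra h
      push Not at h
      have : (x : ℝ) ^ (θ / 2) * (x : ℝ) ^ (θ / 2) < 2 * 2 :=
        mul_lt_mul'' h h (Real.rpow_nonneg hx0.le _) (Real.rpow_nonneg hx0.le _)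
      linarith
    have hNge' : (x : ℝ) ^ (θ / 2) ≤ N := by
      have : (x : ℝ) ^ θ / 2 ≤ N := by linarith
      refine le_trans ?_ this
      rw [le_div_iff₀ (by norm_num : (0 : ℝ) < 2), ← hhalf]
      exact mul_le_mul_of_nonneg_left h2 (Real.rpow_nonneg hx0.le _)
    calc θ / 2 * Real.log x = Real.log ((x : ℝ) ^ (θ / 2)) := by rw [Real.log_rpow hx0]
      _ ≤ Real.log N := Real.log_le_log (by positivity) hNge'
  -- the Euler product and its lower bound
  set E : ℝ := ∏ p ∈ Nat.primesBelow S, ∑ ν ∈ range (2 * k + 1), bCoeff f y (p ^ ν) with hEdef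
  have hEN : E = ∏ p ∈ Nat.primesLE N, ∑ ν ∈ range (2 * k + 1), bCoeff f y (p ^ ν) := by
    rw [hEdef, hSdef, Nat.primesLE]
  have hElow : Λ₀ / 2 * Real.log N ^ κ ≤ E := by
    have h := hN₀ N hN₀le
    rw [hEN]
    rw [lt_div_iff₀ (Real.rpow_pos_of_pos hlogN _)] at h
    exact h.le
  have hElow' : Λ₀ / 2 * ((θ / 2) ^ κ * Real.log x ^ κ) ≤ E := by
    refine le_trans (mul_le_mul_of_nonneg_left ?_ (by positivity)) hElow
    rw [← Real.mul_rpow (by positivity) hlogx.le]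
    exact Real.rpow_le_rpow (by positivity) hlogN_ge hκ0
  have hEpos : 0 < E := lt_of_lt_of_le (by positivity) hElow
  have hE1 : (x : ℝ) + 1 > 0 := by linarith
  -- the pieces
  set A : ℝ := ∑ n ∈ range (x + 1), ∑ d ∈ (tuples f n).filter
      (fun d => ∏ i, d i ≤ x ∧ (∏ i, d i) ∈ Nat.smoothNumbers S), ∏ i, thinWeight y (d i) with hA
  set K : ℝ := ∑ n ∈ range (x + 1), ∑ d ∈ (tuples f n).filter
      (fun d => x < ∏ i, d i ∧ (∏ i, d i) ∈ Nat.smoothNumbers S), ∏ i, thinWeight y (d i) with hKdef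
  set M : ℝ := ∑ m ∈ (Icc 1 x).filter (· ∈ Nat.smoothNumbers S), bCoeff f y m with hM
  set R : ℝ := ∑ m ∈ Icc 1 x, (m : ℝ) * bCoeff f y m with hR
  have hsum := sum_truncStat_eq_add f y S x
  have hsand : |A - ((x : ℝ) + 1) * M| ≤ C₁ * (1 + R) := hC₁ x S
  have hK0 : 0 ≤ K := Finset.sum_nonneg fun _ _ => Finset.sum_nonneg fun d _ => prod_thinWeight_nonneg hy d
  -- Rankin exponent
  set δ : ℝ := 2 / Real.log S with hδ
  have hδ0 : 0 ≤ δ := by positivity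
  obtain ⟨htail0, htail⟩ := mainTerm_tail_bounds f hy S (show 1 ≤ x by exact_mod_cast hx1) hδ0
  have hxδ : (x : ℝ) ^ (-δ) ≤ Real.exp (-1 / θ) := by
    rw [Real.rpow_def_of_pos hx0, Real.exp_le_exp, hδ]
    rw [show Real.log x * -(2 / Real.log S) = -(2 * Real.log x) / Real.log S by ring,
      div_le_div_iff₀ hlogS hθ]
    linarith [hlogS_le']
  have htail' : E - M ≤ Real.exp B * Real.exp (-1 / θ) * E := by
    calc E - M ≤ (x : ℝ) ^ (-δ) * ∏ p ∈ Nat.primesBelow S, ∑ ν ∈ range (2 * k + 1),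
          bCoeff f y (p ^ ν) * ((p ^ ν : ℕ) : ℝ) ^ δ := htail
      _ ≤ Real.exp (-1 / θ) * (Real.exp B * E) := by
          refine mul_le_mul hxδ (hB S hS2) (Finset.prod_nonneg fun p _ => Finset.sum_nonneg fun ν _ =>
            mul_nonneg (hb0 _) (Real.rpow_nonneg (Nat.cast_nonneg _) _)) (Real.exp_pos _).le
      _ = Real.exp B * Real.exp (-1 / θ) * E := by ring
  -- the smooth kernel
  have hKle : K ≤ C₂ * (2 : ℝ) ^ (κ + 1) / Λ₀ * Real.exp (-1 / θ) * (((x : ℝ) + 1) * E) := by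
    have h1 := hK x hxx₂ S hS2
    have hexp : Real.exp (-(2 * Real.log x) / Real.log S) ≤ Real.exp (-1 / θ) := by
      rw [Real.exp_le_exp, div_le_div_iff₀ hlogS hθ]; linarith [hlogS_le']
    have hpow : Real.log S ^ κ ≤ (2 : ℝ) ^ κ * Real.log N ^ κ := by
      rw [← Real.mul_rpow (by norm_num) hlogN.le]
      exact Real.rpow_le_rpow hlogS.le hlogS_le hκ0
    have hlogNκ : Real.log N ^ κ ≤ 2 / Λ₀ * E := by
      rw [div_mul_eq_mul_div, le_div_iff₀ hΛ₀pos]; linarith [hElow]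
    calc K ≤ C₂ * ((x : ℝ) * Real.exp (-(2 * Real.log x) / Real.log S) * Real.log S ^ κ) := h1
      _ ≤ C₂ * ((x : ℝ) * Real.exp (-1 / θ) * ((2 : ℝ) ^ κ * (2 / Λ₀ * E))) := by
          gcongr
          exact hpow.trans (mul_le_mul_of_nonneg_left hlogNκ (by positivity))
      _ = C₂ * (2 : ℝ) ^ κ * 2 / Λ₀ * Real.exp (-1 / θ) * ((x : ℝ) * E) := by
          field_simp
      _ ≤ C₂ * (2 : ℝ) ^ (κ + 1) / Λ₀ * Real.exp (-1 / θ) * (((x : ℝ) + 1) * E) := by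
          rw [Real.rpow_add (by norm_num), Real.rpow_one]
          have : (x : ℝ) * E ≤ ((x : ℝ) + 1) * E := by linarith [hEpos.le]
          have h0 : 0 ≤ C₂ * (2 : ℝ) ^ κ * 2 / Λ₀ * Real.exp (-1 / θ) := by positivity
          calc C₂ * (2 : ℝ) ^ κ * 2 / Λ₀ * Real.exp (-1 / θ) * ((x : ℝ) * E)
              ≤ C₂ * (2 : ℝ) ^ κ * 2 / Λ₀ * Real.exp (-1 / θ) * (((x : ℝ) + 1) * E) :=
                mul_le_mul_of_nonneg_left this h0
            _ = _ := by ring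
  -- the Type-I error
  have herr : C₁ * (1 + R) ≤ ε * (((x : ℝ) + 1) * E) := by
    have hxs' : 1 + R ≤ η * ((x : ℝ) * Real.log x ^ κ) := by
      rwa [div_le_iff₀ (mul_pos hx0 (Real.rpow_pos_of_pos hlogx _))] at hxs
    have hR0 : 0 ≤ 1 + R :=
      add_nonneg zero_le_one (Finset.sum_nonneg fun m _ => mul_nonneg (Nat.cast_nonneg _) (hb0 m))
    calc C₁ * (1 + R) ≤ (C₁ + 1) * (1 + R) := by linarith
      _ ≤ (C₁ + 1) * (η * ((x : ℝ) * Real.log x ^ κ)) := mul_le_mul_of_nonneg_left hxs' (by positivity)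
      _ = ε * ((x : ℝ) * (Λ₀ / 2 * ((θ / 2) ^ κ * Real.log x ^ κ))) := by
          rw [hη]; field_simp
      _ ≤ ε * (((x : ℝ) + 1) * E) := by
          refine mul_le_mul_of_nonneg_left ?_ hε.le
          calc (x : ℝ) * (Λ₀ / 2 * ((θ / 2) ^ κ * Real.log x ^ κ)) ≤ (x : ℝ) * E :=
                mul_le_mul_of_nonneg_left hElow' hx0.le
            _ ≤ ((x : ℝ) + 1) * E := by linarith [hEpos.le]
  -- assemble
  have hden : 0 < ((x : ℝ) + 1) * E := mul_pos hE1 hEpos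
  rw [hsum, div_sub_one hden.ne', abs_div, abs_of_pos hden, div_le_iff₀ hden]
  have hnum : |A + K - ((x : ℝ) + 1) * E| ≤ C₁ * (1 + R) + ((x : ℝ) + 1) * (E - M) + K := by
    have h1 : A + K - ((x : ℝ) + 1) * E = (A - ((x : ℝ) + 1) * M) - ((x : ℝ) + 1) * (E - M) + K := by ring
    rw [h1]
    have h2 : 0 ≤ ((x : ℝ) + 1) * (E - M) := mul_nonneg hE1.le htail0
    calc |(A - ((x : ℝ) + 1) * M) - ((x : ℝ) + 1) * (E - M) + K|
        ≤ |(A - ((x : ℝ) + 1) * M) - ((x : ℝ) + 1) * (E - M)| + |K| := abs_add_le _ _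
      _ ≤ (|A - ((x : ℝ) + 1) * M| + |((x : ℝ) + 1) * (E - M)|) + |K| := by
          gcongr
          simpa only [sub_eq_add_neg, abs_neg] using abs_add_le (A - ((x : ℝ) + 1) * M) (-(((x : ℝ) + 1) * (E - M)))
      _ ≤ (C₁ * (1 + R) + ((x : ℝ) + 1) * (E - M)) + K := by
          rw [abs_of_nonneg h2, abs_of_nonneg hK0]; gcongr
  refine hnum.trans ?_
  have htailx : ((x : ℝ) + 1) * (E - M) ≤ Real.exp B * Real.exp (-1 / θ) * (((x : ℝ) + 1) * E) := by
    calc ((x : ℝ) + 1) * (E - M) ≤ ((x : ℝ) + 1) * (Real.exp B * Real.exp (-1 / θ) * E) :=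
          mul_le_mul_of_nonneg_left htail' hE1.le
      _ = _ := by ring
  calc C₁ * (1 + R) + ((x : ℝ) + 1) * (E - M) + K
      ≤ ε * (((x : ℝ) + 1) * E) + Real.exp B * Real.exp (-1 / θ) * (((x : ℝ) + 1) * E) +
          C₂ * (2 : ℝ) ^ (κ + 1) / Λ₀ * Real.exp (-1 / θ) * (((x : ℝ) + 1) * E) := by linarith
    _ = ((Real.exp B + C₂ * (2 : ℝ) ^ (κ + 1) / Λ₀) * Real.exp (-1 / θ) + ε) * (((x : ℝ) + 1) * E) := by ring

end Law

/-! ### Registered closed forms -/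

/-- **truncStatRatioLaw** (registered closed form, `--supports stmt-Parity-11292`): the `y`-tilted Kubilius model at
height `x^θ` in ratio form, for every Bateman–Horn system and every real `y ≥ 1`. [folklore] -/
theorem truncStatRatioLaw : ∀ (k : ℕ) (f : Fin k → ℤ[X]), IsBatemanHornSystem f → ∀ y : ℝ, 1 ≤ y → ∃ C : ℝ, 0 < C ∧ ∀ θ : ℝ, 0 < θ → θ ≤ 1 → ∀ ε : ℝ, 0 < ε → ∀ᶠ x : ℕ in atTop, |(∑ n ∈ Finset.range (x + 1), y ^ (∑ i, (((f i).eval (n : ℤ)).toNat.factorization.sum fun p v => if p < ⌊(x : ℝ) ^ θ⌋₊ + 1 then min v 2 else 0))) / (((x : ℝ) + 1) * ∏ p ∈ Nat.primesBelow (⌊(x : ℝ) ^ θ⌋₊ + 1), ∑ ν ∈ Finset.range (2 * k + 1), bCoeff f y (p ^ ν)) - 1| ≤ C * Real.exp (-1 / θ) + ε :=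
  fun _k _f hf _y hy => truncStat_ratio_law hf hy


end

end Summit.Parity.BatemanHorn.Cruxes.SystemLSDRealSegment.BetaThinnedRootKernel
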